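import Summits.CriticalPhenomena.Ising3DConformalLimit.Theses.ArmDressing
import HarnessLib

/-!
# Route `ArmDressing`, crux `ArmDressingGlue` (stmt-CriticalPhenomena-15700): vocabulary

Route-posited objects (D-0016 `<Route>Defs` file) shared by the registered stubs of the skeleton
`Cruxes/ArmDressingGlue/Lines/birth.lean` (line `registered`) and by the crux file that composes
them.  Every item of the route `Theses/ArmDressing.lean` is typed over one block of `let`-bound
terms (`μ, PrL, Pr, mesh, disc, arm1, gball, ginv, EVEN, EVEN2, CROSS, pts, fam`); here they are
`def`s with the SAME bodies, so that each item reads, DEFINITIONALLY (`Iff.rfl`), as a statement in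
this vocabulary:

* `oneArmRenormalisedLimit_iff` — the target `X = OneArmRenormalisedLimit`;
* `ballConnectivityMoebius_iff` — crux A (`BallLaw m R lam` names its five clauses for one `lam`);
* `armExtensionFactorisation_iff` — crux C; `evenPatternDecoupling_iff` — crux B;
* `infiniteVolumeEdwardsSokal_iff` — the support ES, as the conjunction
  `WiredBoxLimit ∧ Arm1Pos ∧ EdwardsSokalIdentity` of its clauses (a), (b), (c).

Nothing is asserted.  Also recorded here (statements only): the two Camia–Feng storeys of the line,
`DressedLimitExists` (existence of the `ρ₁`-renormalised limit, CF25 Thm 1 / §3.2.2 transposed)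
and `DressedInversionCovariance` (§3.2.3 transposed), and the NON-DEGENERACY clause
`CrossLawPositive` (positivity of the `δ → 0` lower limit of the CROSS connection law of generalised
balls — the 3D stand-in for the RSW lower bounds that the planar bookkeeping uses tacitly), which the
lead's audit found necessary to transport the ratio limits of B(ii)/C(ii) under the inversion clause
of A.  Small definitional API at the end (`mem_disc`, `mesh_apply`, `gball_of_pos/of_not_pos`,
`isProbabilityMeasure_μ`, `PrL_nonneg`, `PrL_le_one`).

References: F. Camia, Y. Feng, arXiv:2411.01467 (SPA 2025), Thm 1, Lemmas 12–17, §3.2.2–3.2.3;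
G. Grimmett, *The Random-Cluster Model* (2006), §4.2; the line card `Cruxes/ArmDressingGlue/Lines/birth.md`.
-/

noncomputable section

namespace Summit.CriticalPhenomena.Ising3DConformalLimit.Cruxes.ArmDressingGlue.Vocab

open scoped BigOperators Topology Classical MeasureTheory
open Filter Set MeasureTheory
open Literature.Probability.LatticeModels Literature.Probability.Percolation
open Literature.Barriers.CriticalPhenomena
open Summit.CriticalPhenomena.Ising3DConformalLimit.Theses

local notation "E3" => EuclideanSpace ℝ (Fin 3)

/-! ### The route's `let`-vocabulary as definitions (bodies verbatim) -/

/-- The wired critical FK-Ising (`q = 2`, `p = 1 - e^{-2β_c(3)}`) measure of the box `Λ_L ⊂ ℤ³`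
(the route's `μ`). [cite: Grimmett2006, §4.2 (4.11)–(4.12)] -/
def μ : (L : ℕ) → Measure (BondConfig (BoxV 3 L)) :=
  fun L => rcMeasure (boxGraph 3 L) (fkIsingParam (criticalBeta 3)) 2 (boxBoundary 3 L)

/-- Wired-box probability that the open-connection relation among `m` lattice sets lies in `R`
(the route's `PrL`). [cite: CamiaFeng2025, §3.2] -/
def PrL : (m : ℕ) → (Fin m → Set (Site 3)) → Set (Fin m → Fin m → Prop) → ℕ → ℝ :=
  fun _ K R L => (μ L).real {ω | (fun i j => ∃ x y : BoxV 3 L,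
    x.1 ∈ K i ∧ y.1 ∈ K j ∧ (openGraph ω).Reachable x y) ∈ R}

/-- Its `L → ∞` limit (the route's `Pr`; a `limUnder`, a genuine limit under `WiredBoxLimit`).
[cite: Grimmett2006, Thm 4.19] -/
def Pr : (m : ℕ) → (Fin m → Set (Site 3)) → Set (Fin m → Fin m → Prop) → ℝ :=
  fun m K R => limUnder atTop (PrL m K R)

/-- The mesh-`δ` embedding `ℤ³ → ℝ³`, `z ↦ δ z` (the route's `mesh`). [folklore] -/
def mesh : ℝ → Site 3 → E3 := fun δ z => WithLp.toLp 2 fun i : Fin 3 => δ * (z i : ℝ)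

/-- Discretisation at mesh `δ` of a continuum set (the route's `disc`). [folklore] -/
def disc : ℝ → Set E3 → Set (Site 3) := fun δ A => {x | mesh δ x ∈ A}

/-- The one-arm probability `arm1 δ r = φ[0 ↔ ((B(0,r))ᶜ)^δ]` (the route's `arm1`).
[cite: CamiaFeng2025, remark after Thm 1] -/
def arm1 : ℝ → ℝ → ℝ := fun δ r => Pr 2 ![{(0 : Site 3)}, disc δ (Metric.ball (0 : E3) r)ᶜ] {R | R 0 1}

/-- The one-arm renormalisation `ρ₁(δ) = 1 / arm1(δ,1)` of the target. [cite: CamiaFeng2025, remark after Thm 1] -/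
def rho1 : ℝ → ℝ := fun δ => (arm1 δ 1)⁻¹

/-- Generalised ball with data `(c, r)`: the closed ball for `r > 0`, the closed exterior of the open
ball of radius `-r` otherwise (the route's `gball`). [cite: Camia2023, §1] -/
def gball : E3 × ℝ → Set E3 :=
  fun p => if 0 < p.2 then Metric.closedBall p.1 p.2 else (Metric.ball p.1 (-p.2))ᶜ

/-- The action of the unit inversion on generalised-ball data,
`(c, r) ↦ (c/(‖c‖²-r²), r/(‖c‖²-r²))` (the route's `ginv`). [cite: Camia2023, §1] -/
def ginv : E3 × ℝ → E3 × ℝ :=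
  fun p => ((‖p.1‖ ^ 2 - p.2 ^ 2)⁻¹ • p.1, p.2 / (‖p.1‖ ^ 2 - p.2 ^ 2))

/-- `EVEN n`: every index class `{j | R i j}` has even size (the route's `EVEN`). [cite: CamiaFeng2025, §1 (event G)] -/
def EVEN : (n : ℕ) → Set (Fin n → Fin n → Prop) := fun n => {R | ∀ i, Even ({j : Fin n | R i j}.ncard)}

/-- `EVEN2 n`: the even pattern read on the first `n` of `n + n` indices (the route's `EVEN2`).
[cite: CamiaFeng2025, Lemma 12] -/
def EVEN2 : (n : ℕ) → Set (Fin (n + n) → Fin (n + n) → Prop) :=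
  fun n => {R | ∀ i : Fin n, Even ({j : Fin n | R (Fin.castAdd n i) (Fin.castAdd n j)}.ncard)}

/-- `CROSS n`: index `i` is related to index `n + i` for every `i < n` (the route's `CROSS`).
[cite: CamiaFeng2025, Lemma 15] -/
def CROSS : (n : ℕ) → Set (Fin (n + n) → Fin (n + n) → Prop) :=
  fun n => {R | ∀ i : Fin n, R (Fin.castAdd n i) (Fin.natAdd n i)}

/-- The singletons of the lattice approximations of `n` continuum points (the route's `pts`). [folklore] -/
def pts : (n : ℕ) → ℝ → (Fin n → E3) → (Fin n → Set (Site 3)) := fun _ δ z j => {latticeApprox δ (z j)}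

/-- The `n + n` family made of the discretisations of `n` inner and `n` outer continuum sets (the
route's `fam`). [folklore] -/
def fam : (n : ℕ) → ℝ → (Fin n → Set E3) → (Fin n → Set E3) → (Fin (n + n) → Set (Site 3)) :=
  fun _ δ A B => Fin.append (fun j => disc δ (A j)) (fun j => disc δ (B j))

/-! ### The items of the route read through the vocabulary -/

/-- The target `ArmDressing.OneArmRenormalisedLimit` in the vocabulary — definitional. [folklore] -/
theorem oneArmRenormalisedLimit_iff :
    ArmDressing.OneArmRenormalisedLimit ↔
      ((∀ δ ∈ Set.Ioc (0:ℝ) 1, 0 < arm1 δ 1) ∧ ∃ (Δ : ℝ) (S : CorrFamily 3), 0 < Δ ∧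
        HasPointwiseScalingLimit (criticalCorr 3) rho1 S ∧ IsNondegenerateTwoPoint S ∧
          IsMoebiusCovariant Δ S) :=
  Iff.rfl

/-- The five clauses of crux A for ONE relation set: continuity of the limit law `lam` on
non-degenerate data, convergence of the lattice laws to it, and invariance of `lam` under
translations, dilations, `O(3)` and the unit inversion. [cite: Camia2023, Thm 1.1] -/
def BallLaw (m : ℕ) (R : Set (Fin m → Fin m → Prop)) (lam : (Fin m → E3 × ℝ) → ℝ) : Prop :=
  ContinuousOn lam {p | ∀ i, (p i).2 ≠ 0} ∧
  (∀ p : Fin m → E3 × ℝ, (∀ i, (p i).2 ≠ 0) →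
    Tendsto (fun δ => Pr m (fun i => disc δ (gball (p i))) R) (𝓝[>] 0) (𝓝 (lam p))) ∧
  (∀ (p : Fin m → E3 × ℝ) (u : E3), (∀ i, (p i).2 ≠ 0) → lam (fun i => ((p i).1 + u, (p i).2)) = lam p) ∧
  (∀ (p : Fin m → E3 × ℝ) (κ : ℝ), (∀ i, (p i).2 ≠ 0) → 0 < κ →
    lam (fun i => (κ • (p i).1, κ * (p i).2)) = lam p) ∧
  (∀ (p : Fin m → E3 × ℝ) (A : E3 ≃ₗᵢ[ℝ] E3), (∀ i, (p i).2 ≠ 0) →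
    lam (fun i => (A (p i).1, (p i).2)) = lam p) ∧
  (∀ p : Fin m → E3 × ℝ, (∀ i, (p i).2 ≠ 0 ∧ ‖(p i).1‖ ≠ |(p i).2|) →
    lam (fun i => ginv (p i)) = lam p)

/-- Crux A `ArmDressing.BallConnectivityMoebius` in the vocabulary — definitional. [folklore] -/
theorem ballConnectivityMoebius_iff :
    ArmDressing.BallConnectivityMoebius ↔
      ∀ (m : ℕ) (R : Set (Fin m → Fin m → Prop)), ∃ lam : (Fin m → E3 × ℝ) → ℝ, BallLaw m R lam :=
  Iff.rfl

/-- Crux C `ArmDressing.ArmExtensionFactorisation` in the vocabulary — definitional. [folklore] -/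
theorem armExtensionFactorisation_iff :
    ArmDressing.ArmExtensionFactorisation ↔
      ∀ (n : ℕ), 1 ≤ n → ∀ (c : Fin n → E3) (r : Fin n → ℝ), (∀ j, 0 < r j) →
        (∀ j k, j ≠ k → Disjoint (Metric.closedBall (c j) (r j)) (Metric.closedBall (c k) (r k))) →
        ∃ v : (Fin n → E3) → ℝ, ContinuousOn v {z | ∀ j, z j ∈ Metric.ball (c j) (r j)} ∧
          (∀ z : Fin n → E3, (∀ j, z j ∈ Metric.ball (c j) (r j)) → 0 < v z) ∧
          TendstoLocallyUniformlyOn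
            (fun δ z => Pr (n + n) (Fin.append (pts n δ z)
              (fun j => disc δ (Metric.ball (c j) (r j))ᶜ)) (CROSS n) / (arm1 δ 1) ^ n)
            v (𝓝[>] 0) {z | ∀ j, z j ∈ Metric.ball (c j) (r j)} ∧
          (∀ z : Fin n → E3, (∀ j, z j ∈ Metric.ball (c j) (r j)) → ∀ a : Fin n → ℝ, (∀ j, 0 < a j) →
            ∃ (W : ℝ → ℝ) (w : ℝ → ℝ),
              (∀ (ci : ℝ → Fin n → E3) (ri : ℝ → Fin n → ℝ),
                (∀ j, Tendsto (fun η' => ri η' j) (𝓝[>] 0) (𝓝 0)) →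
                (∀ᶠ η' in 𝓝[>] 0, ∀ j, 0 < ri η' j ∧ z j ∈ Metric.ball (ci η' j) (ri η' j / 2)) →
                ∀ᶠ η in 𝓝[>] 0, ∃ Λ : ℝ → ℝ,
                  (∀ᶠ η' in 𝓝[>] 0, Tendsto (fun δ =>
                    Pr (n + n) (fam n δ (fun j => Metric.closedBall (ci η' j) (ri η' j))
                      (fun j => (Metric.ball (c j) (r j))ᶜ)) (CROSS n) /
                    Pr (n + n) (fam n δ (fun j => Metric.closedBall (ci η' j) (ri η' j))
                      (fun j => (Metric.ball (z j) (η * a j))ᶜ)) (CROSS n)) (𝓝[>] 0) (𝓝 (Λ η'))) ∧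
                  Tendsto Λ (𝓝[>] 0) (𝓝 (W η))) ∧
              (∀ (ci : ℝ → E3) (ri : ℝ → ℝ), Tendsto ri (𝓝[>] 0) (𝓝 0) →
                (∀ᶠ η' in 𝓝[>] 0, 0 < ri η' ∧ (0 : E3) ∈ Metric.ball (ci η') (ri η' / 2)) →
                ∀ᶠ η in 𝓝[>] 0, ∃ Λ : ℝ → ℝ,
                  (∀ᶠ η' in 𝓝[>] 0, Tendsto (fun δ =>
                    Pr 2 ![disc δ (Metric.closedBall (ci η') (ri η')), disc δ (Metric.ball (0 : E3) 1)ᶜ]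
                      {R | R 0 1} /
                    Pr 2 ![disc δ (Metric.closedBall (ci η') (ri η')), disc δ (Metric.ball (0 : E3) η)ᶜ]
                      {R | R 0 1}) (𝓝[>] 0) (𝓝 (Λ η'))) ∧
                  Tendsto Λ (𝓝[>] 0) (𝓝 (w η))) ∧
              Tendsto (fun η => W η / ∏ j, w (η * a j)) (𝓝[>] 0) (𝓝 (v z))) :=
  Iff.rfl

/-- Crux B `ArmDressing.EvenPatternDecoupling` in the vocabulary — definitional. [folklore] -/
theorem evenPatternDecoupling_iff :
    ArmDressing.EvenPatternDecoupling ↔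
      ∀ (n : ℕ), 2 ≤ n → Even n → ∀ (c : Fin n → E3) (r : Fin n → ℝ), (∀ j, 0 < r j) →
        (∀ j k, j ≠ k → Disjoint (Metric.closedBall (c j) (r j)) (Metric.closedBall (c k) (r k))) →
        ∃ q : (Fin n → E3) → ℝ, ContinuousOn q {z | ∀ j, z j ∈ Metric.ball (c j) (r j)} ∧
          (∀ z : Fin n → E3, (∀ j, z j ∈ Metric.ball (c j) (r j)) → 0 < q z) ∧
          TendstoLocallyUniformlyOn
            (fun δ z => Pr n (pts n δ z) (EVEN n) /
              Pr (n + n) (Fin.append (pts n δ z) (fun j => disc δ (Metric.ball (c j) (r j))ᶜ)) (CROSS n))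
            q (𝓝[>] 0) {z | ∀ j, z j ∈ Metric.ball (c j) (r j)} ∧
          (∀ z : Fin n → E3, (∀ j, z j ∈ Metric.ball (c j) (r j)) →
            ∀ (ci : ℝ → Fin n → E3) (ri : ℝ → Fin n → ℝ),
              (∀ j, Tendsto (fun η => ri η j) (𝓝[>] 0) (𝓝 0)) →
              (∀ᶠ η in 𝓝[>] 0, ∀ j, 0 < ri η j ∧ z j ∈ Metric.ball (ci η j) (ri η j / 2)) →
              ∃ Λ : ℝ → ℝ,
                (∀ᶠ η in 𝓝[>] 0, Tendsto (fun δ =>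
                  Pr (n + n) (fam n δ (fun j => Metric.closedBall (ci η j) (ri η j))
                    (fun j => (Metric.ball (c j) (r j))ᶜ)) (EVEN2 n ∩ CROSS n) /
                  Pr (n + n) (fam n δ (fun j => Metric.closedBall (ci η j) (ri η j))
                    (fun j => (Metric.ball (c j) (r j))ᶜ)) (CROSS n)) (𝓝[>] 0) (𝓝 (Λ η))) ∧
                Tendsto Λ (𝓝[>] 0) (𝓝 (q z))) :=
  Iff.rfl

/-- Clause (a) of the support ES: for every finite family of lattice sets whose infinite members
pairwise intersect and every relation set, the wired-box probabilities `PrL m K R L` converge as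
`L → ∞` (weak limit of the wired critical FK-Ising measures + no percolation at `p_c(2)` on `ℤ³`;
Grimmett 2006, Thm 4.19 and Prop 5.11).  A statement of this route, not asserted. -/
def WiredBoxLimit : Prop :=
  ∀ (m : ℕ) (K : Fin m → Set (Site 3)) (R : Set (Fin m → Fin m → Prop)),
    (∀ i j, i ≠ j → (K i).Infinite → (K j).Infinite → (K i ∩ K j).Nonempty) →
      ∃ l : ℝ, Tendsto (PrL m K R) atTop (𝓝 l)

/-- Clause (b) of the support ES: `arm1(δ, 1) > 0` for `δ ∈ (0, 1]`.  A statement of this route,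
not asserted. -/
def Arm1Pos : Prop := ∀ δ ∈ Set.Ioc (0:ℝ) 1, 0 < arm1 δ 1

/-- Clause (c) of the support ES: Edwards–Sokal with `+` boundary in infinite volume at `β_c(3)`,
`⟨∏ⱼ σ_{xⱼ}⟩⁺_{β_c} = φ[EVEN(x)]` for injective `x` (uses `m*(β_c) = 0`; Edwards–Sokal 1988, Grimmett 2006
Thm 1.16 / §4.2).  A statement of this route, not asserted. -/
def EdwardsSokalIdentity : Prop :=
  ∀ (n : ℕ) (x : Fin n → Site 3), Function.Injective x → criticalCorr 3 n x = Pr n (fun j => {x j}) (EVEN n)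

/-- The support `ArmDressing.InfiniteVolumeEdwardsSokal` is the conjunction of its three clauses —
definitional. [folklore] -/
theorem infiniteVolumeEdwardsSokal_iff :
    ArmDressing.InfiniteVolumeEdwardsSokal ↔ WiredBoxLimit ∧ Arm1Pos ∧ EdwardsSokalIdentity :=
  Iff.rfl

/-- Registered bookkeeping stub `stub_vocabulary` of the skeleton (the reading of the support ES as the
conjunction of its clauses), through which this vocabulary file lands. [folklore] -/
theorem stub_vocabulary : ArmDressing.InfiniteVolumeEdwardsSokal ↔ WiredBoxLimit ∧ Arm1Pos ∧ EdwardsSokalIdentity :=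
  Iff.rfl

/-! ### Statements of the line's storeys (recorded, not asserted) -/

/-- **Dressed existence** (Camia–Feng 2025 Thm 1, existence half, §3.2.2 transposed to `ℤ³`):
from B, C and ES, the `ρ₁`-renormalised critical correlators have a pointwise scaling limit with
non-degenerate two-point function (Camia–Feng 2025, Thm 1 and §3.2.2).  A statement of this line, not
asserted. -/
def DressedLimitExists : Prop :=
  ArmDressing.EvenPatternDecoupling → ArmDressing.ArmExtensionFactorisation →
    ArmDressing.InfiniteVolumeEdwardsSokal →
      ∃ S : CorrFamily 3, HasPointwiseScalingLimit (criticalCorr 3) rho1 S ∧ IsNondegenerateTwoPoint S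

/-- **Dressed inversion covariance** (Camia–Feng 2025 §3.2.3 transposed to `ℤ³`): given A, B, C
and ES, every normalised, non-degenerate, Euclidean-invariant, scale-covariant (dimension `Δ`)
pointwise scaling limit of the critical correlators under `ρ₁` is covariant under the unit
inversion with the same `Δ` (Camia–Feng 2025, §3.2.3).  A statement of this line, not asserted. -/
def DressedInversionCovariance : Prop :=
  ArmDressing.BallConnectivityMoebius → ArmDressing.EvenPatternDecoupling →
    ArmDressing.ArmExtensionFactorisation → ArmDressing.InfiniteVolumeEdwardsSokal →
      ∀ (Δ : ℝ) (S : CorrFamily 3), HasPointwiseScalingLimit (criticalCorr 3) rho1 S →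
        (∀ n z, z ∉ NonCoincident 3 n → S n z = 0) → IsNondegenerateTwoPoint S →
          IsEuclideanInvariant S → IsScaleCovariant Δ S → IsInversionCovariant Δ S

/-- **Non-degeneracy of the CROSS law** (3D stand-in for the RSW lower bounds of the planar proof,
Camia–Feng 2025 §3.2, "a direct application of RSW arguments and the FKG inequality … c₃ ≤ V_m"):
for every `n` and every family of `n + n` non-degenerate generalised balls, the infinite-volume
probability that the discretised inner member `i` is joined to the outer member `n + i` for every
`i < n` stays bounded away from `0` as the mesh `δ → 0⁺`.  Needed to transport the ratio limits of
B(ii)/C(ii) under the inversion clause of A; absent from A/B/C/ES as typed (cf. Camia–Feng 2025, §3.2.2,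
proof of Lemma 15).  A statement of this line, not asserted. -/
def CrossLawPositive : Prop :=
  ∀ (n : ℕ) (p : Fin (n + n) → E3 × ℝ), (∀ i, (p i).2 ≠ 0) →
    ∃ c : ℝ, 0 < c ∧ ∀ᶠ δ in 𝓝[>] (0:ℝ), c ≤ Pr (n + n) (fun i => disc δ (gball (p i))) (CROSS n)

/-! ### Definitional API -/

/-- Membership in a discretised set. [folklore] -/
@[simp] theorem mem_disc (δ : ℝ) (A : Set E3) (x : Site 3) : x ∈ disc δ A ↔ mesh δ x ∈ A := Iff.rfl

/-- Coordinates of the mesh embedding. [folklore] -/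
@[simp] theorem mesh_apply (δ : ℝ) (z : Site 3) (i : Fin 3) : mesh δ z i = δ * (z i : ℝ) := rfl

/-- The mesh embedding is `meshPos`-linear in `δ`: `mesh δ z = δ • mesh 1 z`. [folklore] -/
theorem mesh_eq_smul (δ : ℝ) (z : Site 3) : mesh δ z = δ • mesh 1 z := by
  ext i; simp [mesh]

/-- A generalised ball with positive radius is the closed ball. [folklore] -/
theorem gball_of_pos {p : E3 × ℝ} (h : 0 < p.2) : gball p = Metric.closedBall p.1 p.2 := if_pos h

/-- A generalised ball with non-positive radius is the closed exterior of the open ball of radius `-r`. [folklore] -/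
theorem gball_of_not_pos {p : E3 × ℝ} (h : ¬ 0 < p.2) : gball p = (Metric.ball p.1 (-p.2))ᶜ := if_neg h

/-- The FK–Ising parameter at `β_c(3)` lies in `[0, 1]`. [folklore] -/
theorem fkIsingParam_criticalBeta_mem_Icc : fkIsingParam (criticalBeta 3) ∈ Set.Icc (0:ℝ) 1 :=
  fkIsingParam_mem_Icc (criticalBeta_nonneg 3)

/-- The wired box measures are probability measures. [cite: Grimmett2006, §1.2] -/
instance isProbabilityMeasure_μ (L : ℕ) : IsProbabilityMeasure (μ L) :=
  isProbabilityMeasure_rcMeasure _ fkIsingParam_criticalBeta_mem_Icc two_pos _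

/-- Wired-box probabilities are nonnegative. [folklore] -/
theorem PrL_nonneg (m : ℕ) (K : Fin m → Set (Site 3)) (R : Set (Fin m → Fin m → Prop)) (L : ℕ) :
    0 ≤ PrL m K R L := measureReal_nonneg

/-- Wired-box probabilities are at most one. [folklore] -/
theorem PrL_le_one (m : ℕ) (K : Fin m → Set (Site 3)) (R : Set (Fin m → Fin m → Prop)) (L : ℕ) :
    PrL m K R L ≤ 1 := measureReal_le_one

/-- Wired-box probabilities are monotone in the relation set. [folklore] -/
theorem PrL_mono_rel (m : ℕ) (K : Fin m → Set (Site 3)) {R R' : Set (Fin m → Fin m → Prop)}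
    (h : R ⊆ R') (L : ℕ) : PrL m K R L ≤ PrL m K R' L :=
  measureReal_mono (fun _ hω => h hω) (measure_ne_top _ _)

end Summit.CriticalPhenomena.Ising3DConformalLimit.Cruxes.ArmDressingGlue.Vocab

end
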